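import Literature.Analysis.FluidPDE.PlanarVorticityEntropyVelocity
import Literature.Analysis.FluidPDE.BiotSavart2DRegularity
import Literature.Analysis.FluidPDE.BiotSavart2DSymmetry
import Literature.Analysis.FluidPDE.LoopCirculation
import Literature.Analysis.FluidPDE.BurgersVortex
import Mathlib.Analysis.SpecialFunctions.SmoothTransition
import HarnessLib

/-!
# The Biot–Savart velocity of a radial vorticity: `(K₂ ∗ w)(x) = m(|x|) x^⊥/(2π|x|²)`,
# `m(r) = ∫_{|y|<r} w`; the Lamb–Oseen velocity `K₂ ∗ G = v^G` of the Gaussian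

Literature file (topic `Analysis/FluidPDE`), theorems only (no definitions, no named facts).

Majda–Bertozzi (*Vorticity and Incompressible Flow*, CUP 2002, §2.2.1, Example 2.1 "radial eddies",
eq. (2.14), held text p. 45): for a radially symmetric vorticity `ω₀(r)` the velocity
`v(x) = (x^⊥/|x|²) ∫₀^{|x|} s ω₀(s) ds` is the (steady) Biot–Savart velocity field; Gallay–Wayne
(*Existence and stability of asymmetric Burgers vortices*, J. Math. Fluid Mech. 9 (2007), (1.5)): the
velocity of the Gaussian `G(ξ) = (4π)⁻¹e^{−|ξ|²/4}` obtained from the Biot–Savart law is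
`v^G(ξ) = (2π)⁻¹ (ξ^⊥/|ξ|²)(1 − e^{−|ξ|²/4})`. The tree has the DIRECTION statement
`biotSavart2D_eq_smul_perp_of_radial` (`v = c(x) x^⊥`, `c` rotation invariant — "without evaluating the
integral", `BiotSavart2DSymmetry`), the `C¹_c` Biot–Savart calculus `curl (K₂ ∗ w) = w`
(`BiotSavart2DRegularity`) and Stokes' theorem for planar discs (`LoopCirculation`). This file EVALUATES the
coefficient:

* §1 (`C¹_c` radial `w`): `circulation_biotSavart2D_circleLoop_eq_polar` (Stokes:
  `∮_{|x|=r} (K₂ ∗ w)·dℓ = ∫₀^r∫₀^{2π} ρ w(ρ cos θ, ρ sin θ) dθ dρ =: m(r)`),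
  `circulation_biotSavart2D_circleLoop_eq_coeff` (`= 2π r² c(r e₀)` for radial `w`), hence
  **`biotSavart2D_radial_eq_smul_perp`**: `(K₂ ∗ w)(x) = (m(|x|)/(2π|x|²)) · x^⊥` for every `x`;
* §2 (Gaussians `w(y) = K e^{−b|y|²}`, `b > 0`, by the radial smooth cut-offs
  `χ_n(y) = smoothTransition((n+2)² − |y|²)` and `‖K₂ ∗ (w − wχ_n)‖_∞ → 0`):
  **`biotSavart2D_gaussian_eq`**: `(K₂ ∗ Ke^{−b|·|²})(x) = (K π (1 − e^{−b|x|²})/(b · 2π|x|²)) · x^⊥`;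
* §3 **`biotSavart2D_gaussVortexProfile`**: `K₂ ∗ G = v^G` (`gaussVortexVelocity`), Gallay–Wayne's (1.5).

## References
* [cite: MajdaBertozziCUP2002, §2.2.1 Example 2.1 eq. (2.14) (radial eddies; held text p. 45)]
* [cite: GallayWayne2006, §1 eq. (1.5) (`v^G` is the Biot–Savart velocity of `G`)]
-/

noncomputable section

namespace Literature.Analysis.FluidPDE

open _root_.MeasureTheory _root_.Real _root_.Set _root_.Filter intervalIntegral
open scoped RealInnerProductSpace Topology

namespace BiotSavart2DRadialEvaluation

/-- `(single 0 1)^⊥ = single 1 1`. [folklore] -/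
private theorem perp_single_zero :
    perp (EuclideanSpace.single 0 (1 : ℝ)) = EuclideanSpace.single 1 (1 : ℝ) := by
  ext i; fin_cases i <;> simp [perp]

/-- `(single 1 1)^⊥ = −single 0 1`. [folklore] -/
private theorem perp_single_one :
    perp (EuclideanSpace.single 1 (1 : ℝ)) = -EuclideanSpace.single 0 (1 : ℝ) := by
  ext i; fin_cases i <;> simp [perp]

/-- The point of the circle: `(ρ cos θ) e₀ + (ρ sin θ) e₁` is the rotation `cos θ · x + sin θ · x^⊥` of
`x = ρ e₀`. [folklore] -/
private theorem circlePoint_eq_rotate (ρ θ : ℝ) :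
    ((ρ * cos θ) • EuclideanSpace.single 0 (1 : ℝ) + (ρ * sin θ) • EuclideanSpace.single 1 (1 : ℝ) :
      EuclideanSpace ℝ (Fin 2)) =
      cos θ • (ρ • EuclideanSpace.single 0 (1 : ℝ)) + sin θ • perp (ρ • EuclideanSpace.single 0 (1 : ℝ)) := by
  rw [perp_smul, perp_single_zero, smul_smul, smul_smul, mul_comm ρ, mul_comm ρ]

/-- The tangent of the circle is the `⊥` of its point. [folklore] -/
private theorem circleTangent_eq_perp (ρ θ : ℝ) :
    ((-(ρ * sin θ)) • EuclideanSpace.single 0 (1 : ℝ) + (ρ * cos θ) • EuclideanSpace.single 1 (1 : ℝ) :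
      EuclideanSpace ℝ (Fin 2)) =
      perp ((ρ * cos θ) • EuclideanSpace.single 0 (1 : ℝ) + (ρ * sin θ) • EuclideanSpace.single 1 (1 : ℝ)) := by
  rw [perp_add, perp_smul, perp_smul, perp_single_zero, perp_single_one, smul_neg, ← neg_smul, add_comm]

/-- `‖ρ e₀‖² = ρ²`. [folklore] -/
private theorem norm_sq_smul_single_zero (ρ : ℝ) :
    ‖(ρ • EuclideanSpace.single 0 (1 : ℝ) : EuclideanSpace ℝ (Fin 2))‖ ^ 2 = ρ ^ 2 := by
  rw [norm_smul, Real.norm_eq_abs, mul_pow, sq_abs]; simp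

end BiotSavart2DRadialEvaluation

open BiotSavart2DRadialEvaluation

/-! ### §1 Radial `C¹_c` vorticities -/

section RadialCore

variable {w : EuclideanSpace ℝ (Fin 2) → ℝ}

/-- **Stokes for the Biot–Savart velocity of a `C¹_c` vorticity**: the circulation of `K₂ ∗ w` around
the circle of radius `r` about the origin is the polar integral of `w` over the disc,
`∮ (K₂ ∗ w)·dℓ = ∫₀^r ∫₀^{2π} ρ w(ρ cos θ e₀ + ρ sin θ e₁) dθ dρ` (`curl (K₂ ∗ w) = w`).
[cite: MajdaBertozziCUP2002, §1.6 (1.60)–(1.61) and §2.2.1 Example 2.1 (held text p. 45)] -/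
theorem circulation_biotSavart2D_circleLoop_eq_polar (hw : ContDiff ℝ 1 w) (hwc : HasCompactSupport w)
    (r : ℝ) :
    circulation (biotSavart2D w)
        (circleLoop 0 r (EuclideanSpace.single 0 (1 : ℝ)) (EuclideanSpace.single 1 (1 : ℝ))) =
      ∫ ρ in (0 : ℝ)..r, ∫ θ in (0 : ℝ)..2 * π,
        ρ * w ((ρ * cos θ) • EuclideanSpace.single 0 (1 : ℝ) + (ρ * sin θ) • EuclideanSpace.single 1 (1 : ℝ)) := by
  have hv : ContDiff ℝ 1 (biotSavart2D w) := by
    have h := contDiff_biotSavart2D (n := 1) (by exact_mod_cast hw) hwc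
    exact_mod_cast h
  rw [circulation_circleLoop_eq_integral_fderiv hv 0 _ _ r]
  refine intervalIntegral.integral_congr fun ρ _ => ?_
  refine intervalIntegral.integral_congr fun θ _ => ?_
  simp only [zero_add]
  rw [EuclideanSpace.inner_single_right, EuclideanSpace.inner_single_right]
  simp only [one_mul, conj_trivial]
  rw [curl_biotSavart2D_eq hw hwc]

/-- **The circulation of an azimuthal field**: for a RADIAL `w` (invariant under all linear isometries;
`w ∈ L¹ ∩ L^∞` is not needed) the circulation of `v = K₂ ∗ w` around the circle of radius `r` is
`2π r² c`, `c = ⟪v(r e₀), (r e₀)^⊥⟫/r²` the (rotation-invariant) azimuthal coefficient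
(`biotSavart2D_eq_smul_perp_of_radial`, `azimuthalCoeff_rotation_of_radial`). [cite: MajdaBertozziCUP2002, §2.2.1 Example 2.1 eq. (2.14) (held text p. 45)] -/
theorem circulation_biotSavart2D_circleLoop_eq_coeff
    (hrad : ∀ (T : EuclideanSpace ℝ (Fin 2) ≃ₗᵢ[ℝ] EuclideanSpace ℝ (Fin 2)) (y), w (T y) = w y) (r : ℝ) :
    circulation (biotSavart2D w)
        (circleLoop 0 r (EuclideanSpace.single 0 (1 : ℝ)) (EuclideanSpace.single 1 (1 : ℝ))) =
      2 * π * r ^ 2 *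
        (⟪biotSavart2D w (r • EuclideanSpace.single 0 (1 : ℝ)), perp (r • EuclideanSpace.single 0 (1 : ℝ))⟫ /
          ‖(r • EuclideanSpace.single 0 (1 : ℝ) : EuclideanSpace ℝ (Fin 2))‖ ^ 2) := by
  set x : EuclideanSpace ℝ (Fin 2) := r • EuclideanSpace.single 0 (1 : ℝ) with hx
  set c : ℝ := ⟪biotSavart2D w x, perp x⟫ / ‖x‖ ^ 2 with hc
  rw [circulation_circleLoop]
  have hpt : ∀ θ : ℝ,
      ⟪biotSavart2D w ((0 : EuclideanSpace ℝ (Fin 2)) + (r * cos θ) • EuclideanSpace.single 0 (1 : ℝ) +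
          (r * sin θ) • EuclideanSpace.single 1 (1 : ℝ)),
        (-(r * sin θ)) • EuclideanSpace.single 0 (1 : ℝ) + (r * cos θ) • EuclideanSpace.single 1 (1 : ℝ)⟫ =
      c * r ^ 2 := by
    intro θ
    obtain ⟨R, hR⟩ := exists_planarRotation (cos θ) (sin θ) (cos_sq_add_sin_sq θ)
    have hp : ((r * cos θ) • EuclideanSpace.single 0 (1 : ℝ) + (r * sin θ) • EuclideanSpace.single 1 (1 : ℝ) :
        EuclideanSpace ℝ (Fin 2)) = R x := by
      rw [hR, hx, circlePoint_eq_rotate]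
    rw [zero_add, circleTangent_eq_perp, hp, biotSavart2D_eq_smul_perp_of_radial hrad (R x),
      azimuthalCoeff_rotation_of_radial hrad hR x, ← hc, inner_smul_left, inner_perp_perp,
      real_inner_self_eq_norm_sq, LinearIsometryEquiv.norm_map, hx, norm_sq_smul_single_zero]
    simp
  simp_rw [hpt]
  rw [intervalIntegral.integral_const, smul_eq_mul]
  ring

/-- **THE BIOT–SAVART VELOCITY OF A RADIAL `C¹_c` VORTICITY** (Majda–Bertozzi's radial eddies): for
every `x`,
`(K₂ ∗ w)(x) = (m(|x|) / (2π|x|²)) · x^⊥`, `m(r) = ∫₀^r ∫₀^{2π} ρ w(ρ cos θ e₀ + ρ sin θ e₁) dθ dρ`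
(the mass of `w` in the disc of radius `r`; at `x = 0` both sides vanish).
[cite: MajdaBertozziCUP2002, §2.2.1 Example 2.1 eq. (2.14) (held text p. 45)] -/
theorem biotSavart2D_radial_eq_smul_perp (hw : ContDiff ℝ 1 w) (hwc : HasCompactSupport w)
    (hrad : ∀ (T : EuclideanSpace ℝ (Fin 2) ≃ₗᵢ[ℝ] EuclideanSpace ℝ (Fin 2)) (y), w (T y) = w y)
    (x : EuclideanSpace ℝ (Fin 2)) :
    biotSavart2D w x =
      ((∫ ρ in (0 : ℝ)..‖x‖, ∫ θ in (0 : ℝ)..2 * π,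
          ρ * w ((ρ * cos θ) • EuclideanSpace.single 0 (1 : ℝ) + (ρ * sin θ) • EuclideanSpace.single 1 (1 : ℝ))) /
        (2 * π * ‖x‖ ^ 2)) • perp x := by
  by_cases hx0 : x = 0
  · subst hx0; simp [biotSavart2D_zero_of_radial hrad]
  have hxn : 0 < ‖x‖ := norm_pos_iff.2 hx0
  -- rotate `‖x‖ e₀` to `x`
  set x₀ : EuclideanSpace ℝ (Fin 2) := ‖x‖ • EuclideanSpace.single 0 (1 : ℝ) with hx₀
  obtain ⟨R, hR⟩ := exists_planarRotation (x 0 / ‖x‖) (x 1 / ‖x‖) (by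
    have hn : ‖x‖ ^ 2 = x 0 ^ 2 + x 1 ^ 2 := by
      rw [EuclideanSpace.norm_sq_eq, Fin.sum_univ_two, Real.norm_eq_abs, Real.norm_eq_abs, sq_abs, sq_abs]
    field_simp
    linarith)
  have hRx : R x₀ = x := by
    rw [hR, hx₀, perp_smul, perp_single_zero, smul_smul, smul_smul]
    ext i; fin_cases i <;> simp <;> field_simp
  -- the coefficient at `x` is the coefficient at `x₀`
  have hcoeff : ⟪biotSavart2D w x, perp x⟫ / ‖x‖ ^ 2 = ⟪biotSavart2D w x₀, perp x₀⟫ / ‖x₀‖ ^ 2 := by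
    rw [← hRx]; exact azimuthalCoeff_rotation_of_radial hrad hR x₀
  -- Stokes + the azimuthal computation at radius `‖x‖`
  have h1 := circulation_biotSavart2D_circleLoop_eq_polar hw hwc ‖x‖
  have h2 := circulation_biotSavart2D_circleLoop_eq_coeff hrad ‖x‖
  rw [biotSavart2D_eq_smul_perp_of_radial hrad x, hcoeff]
  congr 1
  rw [h1] at h2
  -- `h2 : m = 2π‖x‖² c₀`
  have hπ : (0 : ℝ) < 2 * π * ‖x‖ ^ 2 := by positivity
  rw [eq_div_iff hπ.ne', h2, ← hx₀]
  ring

end RadialCore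

/-! ### §2 Gaussian vorticities, by radial smooth cut-offs -/

namespace BiotSavart2DRadialEvaluation

/-- The planar Gaussian `e^{−b‖y‖²}` (`b > 0`) is integrable. [folklore] -/
private theorem integrable_exp_neg_mul_norm_sq {b : ℝ} (hb : 0 < b) :
    Integrable (fun y : EuclideanSpace ℝ (Fin 2) => exp (-(b * ‖y‖ ^ 2)))
      (volume : Measure (EuclideanSpace ℝ (Fin 2))) := by
  have h := GaussianFourier.integral_rexp_neg_mul_sq_norm (V := EuclideanSpace ℝ (Fin 2)) hb
  have e : (fun y : EuclideanSpace ℝ (Fin 2) => exp (-(b * ‖y‖ ^ 2))) = fun y => exp (-b * ‖y‖ ^ 2) := by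
    funext y; rw [neg_mul]
  rw [e]
  by_contra hni
  rw [integral_undef hni, finrank_euclideanSpace_fin] at h
  have : (0 : ℝ) < (π / b) ^ ((2 : ℕ) / 2 : ℝ) := Real.rpow_pos_of_pos (by positivity) _
  linarith

/-- The radial smooth cut-off `χ_a(y) = smoothTransition(a − ‖y‖²)` times the Gaussian is `C¹` (indeed
smooth). [folklore] -/
private theorem contDiff_gaussian_cutoff (K b a : ℝ) :
    ContDiff ℝ 1 (fun y : EuclideanSpace ℝ (Fin 2) =>
      K * exp (-(b * ‖y‖ ^ 2)) * Real.smoothTransition (a - ‖y‖ ^ 2)) := by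
  have h1 : ContDiff ℝ 1 (fun y : EuclideanSpace ℝ (Fin 2) => ‖y‖ ^ 2) := contDiff_norm_sq ℝ
  have h2 : ContDiff ℝ 1 (fun y : EuclideanSpace ℝ (Fin 2) => Real.smoothTransition (a - ‖y‖ ^ 2)) := by
    have hs : ContDiff ℝ 1 Real.smoothTransition := by
      have := Real.smoothTransition.contDiff (n := 1)
      exact_mod_cast this
    exact hs.comp (contDiff_const.sub h1)
  exact (contDiff_const.mul (contDiff_const.mul h1).neg.exp).mul h2

/-- The cut-off Gaussian has compact support (inside the closed ball of radius `√|a| + 1`, indeed wherever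
`‖y‖² ≥ a`). [folklore] -/
private theorem hasCompactSupport_gaussian_cutoff (K b a : ℝ) :
    HasCompactSupport (fun y : EuclideanSpace ℝ (Fin 2) =>
      K * exp (-(b * ‖y‖ ^ 2)) * Real.smoothTransition (a - ‖y‖ ^ 2)) := by
  refine HasCompactSupport.intro (isCompact_closedBall (0 : EuclideanSpace ℝ (Fin 2)) (|a| + 1)) ?_
  intro y hy
  rw [Metric.mem_closedBall, dist_zero_right, not_le] at hy
  have ha : a - ‖y‖ ^ 2 ≤ 0 := by nlinarith [le_abs_self a, abs_nonneg a, norm_nonneg y]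
  rw [Real.smoothTransition.zero_of_nonpos ha, mul_zero]

/-- The cut-off Gaussian is radial. [folklore] -/
private theorem gaussian_cutoff_radial (K b a : ℝ) (T : EuclideanSpace ℝ (Fin 2) ≃ₗᵢ[ℝ] EuclideanSpace ℝ (Fin 2))
    (y : EuclideanSpace ℝ (Fin 2)) :
    K * exp (-(b * ‖T y‖ ^ 2)) * Real.smoothTransition (a - ‖T y‖ ^ 2) =
      K * exp (-(b * ‖y‖ ^ 2)) * Real.smoothTransition (a - ‖y‖ ^ 2) := by
  rw [LinearIsometryEquiv.norm_map]

/-- The cut-off is `1` on the disc `‖y‖² ≤ a − 1`. [folklore] -/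
private theorem gaussian_cutoff_eq_of_le {K b a : ℝ} {y : EuclideanSpace ℝ (Fin 2)} (hy : ‖y‖ ^ 2 ≤ a - 1) :
    K * exp (-(b * ‖y‖ ^ 2)) * Real.smoothTransition (a - ‖y‖ ^ 2) = K * exp (-(b * ‖y‖ ^ 2)) := by
  rw [Real.smoothTransition.one_of_one_le (by linarith), mul_one]

/-- The norm of a point of the circle of radius `ρ`: `‖(ρ cos θ) e₀ + (ρ sin θ) e₁‖² = ρ²`. [folklore] -/
private theorem norm_sq_circlePoint (ρ θ : ℝ) :
    ‖((ρ * cos θ) • EuclideanSpace.single 0 (1 : ℝ) + (ρ * sin θ) • EuclideanSpace.single 1 (1 : ℝ) :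
      EuclideanSpace ℝ (Fin 2))‖ ^ 2 = ρ ^ 2 := by
  rw [EuclideanSpace.norm_sq_eq, Fin.sum_univ_two, Real.norm_eq_abs, Real.norm_eq_abs, sq_abs, sq_abs]
  simp
  nlinarith [sin_sq_add_cos_sq θ]

/-- The Gaussian's mass in the disc of radius `r`: `∫₀^r∫₀^{2π} ρ K e^{−bρ²} dθ dρ = Kπ(1 − e^{−br²})/b`
(`b ≠ 0`). [folklore] -/
private theorem polarMass_gaussian {b : ℝ} (hb : b ≠ 0) (K r : ℝ) :
    ∫ ρ in (0 : ℝ)..r, ∫ _θ in (0 : ℝ)..2 * π, ρ * (K * exp (-(b * ρ ^ 2))) =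
      K * π * (1 - exp (-(b * r ^ 2))) / b := by
  simp_rw [intervalIntegral.integral_const, smul_eq_mul]
  have hF : ∀ ρ ∈ uIcc 0 r, HasDerivAt (fun ρ : ℝ => -(K * π / b) * exp (-(b * ρ ^ 2))) ((2 * π - 0) * (ρ * (K * exp (-(b * ρ ^ 2))))) ρ := by
    intro ρ _
    have h0 : HasDerivAt (fun ρ : ℝ => b * ρ ^ 2) (b * (2 * ρ)) ρ := by
      have := (hasDerivAt_pow 2 ρ).const_mul b
      simpa using this
    have h1 : HasDerivAt (fun ρ : ℝ => -(b * ρ ^ 2)) (-(b * (2 * ρ))) ρ := h0.neg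
    have h2 := h1.exp.const_mul (-(K * π / b))
    refine h2.congr_deriv ?_
    field_simp
    ring
  rw [intervalIntegral.integral_eq_sub_of_hasDerivAt hF
    ((by fun_prop : Continuous fun ρ : ℝ => (2 * π - 0) * (ρ * (K * exp (-(b * ρ ^ 2))))).intervalIntegrable _ _)]
  simp
  field_simp
  ring

end BiotSavart2DRadialEvaluation

section Gaussian

/-- **THE BIOT–SAVART VELOCITY OF A PLANAR GAUSSIAN**: for `b > 0` and all real `K`, at every `x`,
`(K₂ ∗ (K e^{−b|·|²}))(x) = (K π (1 − e^{−b|x|²}) / (b · 2π|x|²)) · x^⊥`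
— §1 for the radial `C¹_c` cut-offs `K e^{−b|y|²} χ_n(y)`, `χ_n = smoothTransition((n+2)² − |y|²)` (equal to
the Gaussian on `|y| ≤ n + 1`, so with the same disc masses up to radius `n + 1`), and
`‖K₂ ∗ (w − wχ_n)‖_∞ ≤ ((2|K|) ‖w − wχ_n‖₁/2π)^{1/2} → 0` (dominated convergence).
[cite: MajdaBertozziCUP2002, §2.2.1 Example 2.1 eq. (2.14) (held text p. 45); GallayWayne2006, §1 eq. (1.5)] -/
theorem biotSavart2D_gaussian_eq {b : ℝ} (hb : 0 < b) (K : ℝ) (x : EuclideanSpace ℝ (Fin 2)) :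
    biotSavart2D (fun y => K * exp (-(b * ‖y‖ ^ 2))) x =
      (K * π * (1 - exp (-(b * ‖x‖ ^ 2))) / b / (2 * π * ‖x‖ ^ 2)) • perp x := by
  set w : EuclideanSpace ℝ (Fin 2) → ℝ := fun y => K * exp (-(b * ‖y‖ ^ 2)) with hw
  set wn : ℕ → EuclideanSpace ℝ (Fin 2) → ℝ := fun n y =>
    K * exp (-(b * ‖y‖ ^ 2)) * Real.smoothTransition (((n : ℝ) + 2) ^ 2 - ‖y‖ ^ 2) with hwn
  set V : EuclideanSpace ℝ (Fin 2) := (K * π * (1 - exp (-(b * ‖x‖ ^ 2))) / b / (2 * π * ‖x‖ ^ 2)) • perp x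
    with hV
  -- (1) for `n + 1 ≥ ‖x‖` the cut-off velocity at `x` is exactly `V`
  have hcut : ∀ n : ℕ, ‖x‖ ≤ (n : ℝ) + 1 → biotSavart2D (wn n) x = V := by
    intro n hn
    rw [biotSavart2D_radial_eq_smul_perp (contDiff_gaussian_cutoff K b _) (hasCompactSupport_gaussian_cutoff K b _)
      (fun T y => gaussian_cutoff_radial K b _ T y) x, hV]
    congr 1
    have hm : ∫ ρ in (0 : ℝ)..‖x‖, ∫ θ in (0 : ℝ)..2 * π,
        ρ * wn n ((ρ * cos θ) • EuclideanSpace.single 0 (1 : ℝ) + (ρ * sin θ) • EuclideanSpace.single 1 (1 : ℝ)) =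
        ∫ ρ in (0 : ℝ)..‖x‖, ∫ θ in (0 : ℝ)..2 * π, ρ * (K * exp (-(b * ρ ^ 2))) := by
      refine intervalIntegral.integral_congr fun ρ hρ => ?_
      refine intervalIntegral.integral_congr fun θ _ => ?_
      rw [uIcc_of_le (norm_nonneg x)] at hρ
      have hρ2 : ρ ^ 2 ≤ ((n : ℝ) + 2) ^ 2 - 1 := by nlinarith [hρ.1, hρ.2, norm_nonneg x]
      simp only [hwn]
      rw [norm_sq_circlePoint, Real.smoothTransition.one_of_one_le (by linarith), mul_one]
    rw [hm, polarMass_gaussian hb.ne']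
  -- (2) `‖K₂ ∗ w (x) − K₂ ∗ wn (x)‖ → 0`
  have hwi : Integrable w := (integrable_exp_neg_mul_norm_sq hb).const_mul K
  have hwA : ∀ y, |w y| ≤ |K| := fun y => by
    simp only [hw]; rw [abs_mul, abs_of_pos (exp_pos _)]
    exact mul_le_of_le_one_right (abs_nonneg K) (exp_le_one_iff.2 (by nlinarith [norm_nonneg y, sq_nonneg ‖y‖]))
  have hχ01 : ∀ (n : ℕ) (y : EuclideanSpace ℝ (Fin 2)),
      0 ≤ Real.smoothTransition (((n : ℝ) + 2) ^ 2 - ‖y‖ ^ 2) ∧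
        Real.smoothTransition (((n : ℝ) + 2) ^ 2 - ‖y‖ ^ 2) ≤ 1 :=
    fun n y => ⟨Real.smoothTransition.nonneg _, Real.smoothTransition.le_one _⟩
  have hwnA : ∀ n y, |wn n y| ≤ |K| := fun n y => by
    simp only [hwn]; rw [abs_mul]
    exact (mul_le_of_le_one_right (abs_nonneg _) (by rw [abs_of_nonneg (hχ01 n y).1]; exact (hχ01 n y).2)).trans
      (hwA y)
  have hwnc : ∀ n, Continuous (wn n) := fun n => (contDiff_gaussian_cutoff K b _).continuous
  have hwni : ∀ n, Integrable (wn n) := fun n =>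
    (hwnc n).integrable_of_hasCompactSupport (hasCompactSupport_gaussian_cutoff K b _)
  have hL1 : Tendsto (fun n => ∫ y, |w y - wn n y|) atTop (𝓝 0) := by
    have h := tendsto_integral_of_dominated_convergence (fun y => |w y|)
      (F := fun n y => |w y - wn n y|) (f := fun _ => 0) (μ := volume)
      (fun n => ((hwi.sub (hwni n)).abs).aestronglyMeasurable) hwi.abs
      (fun n => Eventually.of_forall fun y => by
        rw [Real.norm_eq_abs, abs_abs]
        simp only [hw, hwn]
        rw [← mul_one_sub, abs_mul]
        refine mul_le_of_le_one_right (abs_nonneg _) ?_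
        rw [abs_of_nonneg (by linarith [(hχ01 n y).2])]
        linarith [(hχ01 n y).1])
      (Eventually.of_forall fun y => by
        refine tendsto_atTop_of_eventually_const (i₀ := ⌈‖y‖⌉₊) fun n hn => ?_
        have hn' : ‖y‖ ≤ (n : ℝ) := (Nat.le_ceil _).trans (by exact_mod_cast hn)
        simp only [hw, hwn]
        rw [Real.smoothTransition.one_of_one_le (by nlinarith [norm_nonneg y]), mul_one, sub_self, abs_zero])
    simpa using h
  -- (3) conclude: `‖K₂ ∗ w (x) − V‖ ≤ ((2|K|) ε_n / 2π)^{1/2} → 0`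
  have hbound : ∀ n : ℕ, ‖x‖ ≤ (n : ℝ) + 1 →
      ‖biotSavart2D w x - V‖ ≤ Real.sqrt ((|K| + |K|) * (∫ y, |w y - wn n y|) / (2 * π)) := fun n hn => by
    rw [← hcut n hn]
    exact norm_biotSavart2D_sub_biotSavart2D_le_sqrt hwi hwA (hwni n) (hwnA n) x
  have hlim : Tendsto (fun n : ℕ => Real.sqrt ((|K| + |K|) * (∫ y, |w y - wn n y|) / (2 * π))) atTop (𝓝 0) := by
    have h := ((hL1.const_mul (|K| + |K|)).div_const (2 * π)).sqrt
    simpa using h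
  have hle : ‖biotSavart2D w x - V‖ ≤ 0 :=
    ge_of_tendsto hlim (Filter.eventually_atTop.2 ⟨⌈‖x‖⌉₊, fun n hn =>
      hbound n ((Nat.le_ceil _).trans ((show (⌈‖x‖⌉₊ : ℝ) ≤ n by exact_mod_cast hn).trans (by linarith)))⟩)
  exact sub_eq_zero.1 (norm_le_zero_iff.1 hle)

/-- **GALLAY–WAYNE (1.5): THE LAMB–OSEEN VELOCITY IS THE BIOT–SAVART VELOCITY OF THE GAUSSIAN**,
`K₂ ∗ G = v^G` with `G = (4π)⁻¹e^{−|ξ|²/4}` (`gaussVortexProfile`) and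
`v^G(ξ) = (2π|ξ|²)⁻¹(1 − e^{−|ξ|²/4}) ξ^⊥` (`gaussVortexVelocity`). [cite: GallayWayne2006, §1 eq. (1.5)] -/
theorem biotSavart2D_gaussVortexProfile (ξ : EuclideanSpace ℝ (Fin 2)) :
    biotSavart2D gaussVortexProfile ξ = gaussVortexVelocity ξ := by
  have hG : gaussVortexProfile = fun y : EuclideanSpace ℝ (Fin 2) => (4 * π)⁻¹ * exp (-(4⁻¹ * ‖y‖ ^ 2)) := by
    funext y; rw [gaussVortexProfile]; congr 2; ring
  rw [hG, biotSavart2D_gaussian_eq (by norm_num) _ ξ]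
  by_cases hξ : ξ = 0
  · subst hξ; ext i; fin_cases i <;> simp [gaussVortexVelocity, perp]
  have hn : ‖ξ‖ ^ 2 ≠ 0 := by positivity
  rw [gaussVortexVelocity_eq_of_ne_zero hξ]
  congr 1
  rw [show -(4⁻¹ * ‖ξ‖ ^ 2) = -(‖ξ‖ ^ 2 / 4) by ring]
  field_simp

/-- **THE BURGERS SWIRL IS THE BIOT–SAVART VELOCITY OF THE BURGERS VORTICITY CROSS-SECTION**: for
`γ, ν > 0`, every real `Γ` and every `y`,
`(K₂ ∗ ω_B(ι ·))(y) = (Γ(1 − e^{−γ|y|²/(4ν)})/(2π|y|²)) · y^⊥ = π(v_B(ι y))`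
(`burgersVorticity`, `burgersVortexSwirl` of `BurgersVortex`; `ι = embedXY`, `π = projXY`).
[cite: GallayWayne2006, §1 eqs. (1.4)–(1.5); Frisch1995, §8.9.1 eq. (8.140)] -/
theorem biotSavart2D_burgersVorticity_slice {γ ν : ℝ} (hγ : 0 < γ) (hν : 0 < ν) (Γ : ℝ)
    (y : EuclideanSpace ℝ (Fin 2)) :
    biotSavart2D (fun y' => burgersVorticity γ ν Γ (embedXY y')) y =
      (Γ * (1 - exp (-(γ * ‖y‖ ^ 2 / (4 * ν)))) / (2 * π * ‖y‖ ^ 2)) • perp y ∧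
    biotSavart2D (fun y' => burgersVorticity γ ν Γ (embedXY y')) y = projXY (burgersVortexSwirl γ ν Γ (embedXY y)) := by
  have hslice : (fun y' : EuclideanSpace ℝ (Fin 2) => burgersVorticity γ ν Γ (embedXY y')) =
      fun y' => γ * Γ / (4 * π * ν) * exp (-(γ / (4 * ν) * ‖y'‖ ^ 2)) := by
    funext y'
    have hn : ‖y'‖ ^ 2 = y' 0 ^ 2 + y' 1 ^ 2 := by
      rw [EuclideanSpace.norm_sq_eq, Fin.sum_univ_two, Real.norm_eq_abs, Real.norm_eq_abs, sq_abs, sq_abs]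
    rw [burgersVorticity, embedXY_apply_zero, embedXY_apply_one, hn]
    congr 2; ring
  have h1 : biotSavart2D (fun y' => burgersVorticity γ ν Γ (embedXY y')) y =
      (Γ * (1 - exp (-(γ * ‖y‖ ^ 2 / (4 * ν)))) / (2 * π * ‖y‖ ^ 2)) • perp y := by
    rw [hslice, biotSavart2D_gaussian_eq (by positivity) _ y]
    congr 1
    rw [show -(γ / (4 * ν) * ‖y‖ ^ 2) = -(γ * ‖y‖ ^ 2 / (4 * ν)) by ring]
    field_simp
  refine ⟨h1, ?_⟩
  rw [h1]
  have hn : ‖y‖ ^ 2 = y 0 ^ 2 + y 1 ^ 2 := by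
    rw [EuclideanSpace.norm_sq_eq, Fin.sum_univ_two, Real.norm_eq_abs, Real.norm_eq_abs, sq_abs, sq_abs]
  by_cases hy : y = 0
  · subst hy
    ext i; fin_cases i <;> simp [burgersVortexSwirl, rotGen, perp]
  have hy2 : y 0 ^ 2 + y 1 ^ 2 ≠ 0 := by rw [← hn]; positivity
  have hx : (embedXY y) 0 ^ 2 + (embedXY y) 1 ^ 2 ≠ 0 := by simpa using hy2
  rw [burgersVortexSwirl_eq_of_ne_zero hγ.ne' hν.ne' Γ hx]
  have hcoef : Γ * (1 - exp (-(γ * ‖y‖ ^ 2 / (4 * ν)))) / (2 * π * ‖y‖ ^ 2) =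
      Γ / (2 * π * ((embedXY y) 0 ^ 2 + (embedXY y) 1 ^ 2)) *
        (1 - exp (-(γ * ((embedXY y) 0 ^ 2 + (embedXY y) 1 ^ 2) / (4 * ν)))) := by
    simp only [embedXY_apply_zero, embedXY_apply_one, ← hn]; ring
  rw [hcoef]
  ext i; fin_cases i <;> simp [rotGen, perp]

end Gaussian

end Literature.Analysis.FluidPDE
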